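import Mathlib
import Summits.NavierStokesRegularity.NavierStokesRegularity.Theses.TypeIQuarterGate
import Summits.NavierStokesRegularity.NavierStokesRegularity.Theses.ExtremalTypeIConstant
import Summits.NavierStokesRegularity.NavierStokesRegularity.Theorems.ExtremalTypeIConstantSelfSimilarExcluded
import Summits.NavierStokesRegularity.NavierStokesRegularity.Theorems.SqueezeCycleExtremalElementExistsExtraction
import Summits.NavierStokesRegularity.NavierStokesRegularity.Theorems.SymmetryModuliCountLinearLiouvilleSevenFiniteEnergy
import Summits.NavierStokesRegularity.NavierStokesRegularity.Theorems.LerayQuarterDissipationFiniteDissipationLiouvilleDssCorners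
import Summits.NavierStokesRegularity.NavierStokesRegularity.Theorems.TypeIQuarterGateScarZoomDefs
import Summits.NavierStokesRegularity.NavierStokesRegularity.Theorems.QuarterLogPincerThinCascadeDefs
import Literature.Analysis.FluidPDE.TypeIAncientMild
import Literature.Analysis.FluidPDE.TypeIAncientMildRescale
import Literature.Analysis.FluidPDE.SelfSimilar
import Literature.Analysis.FluidPDE.ChaeWolfRemovingDSS
import Summits.NavierStokesRegularity.NavierStokesRegularity.Theorems.QuantisedSymmetryPolyhedralDssProfileExistsStubAncientMildOfClassicalTypeI
import Literature.Barriers.NavierStokesRegularity.NearOneDssTypeIExclusion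
import Summits.NavierStokesRegularity.NavierStokesRegularity.Theorems.TypeIQuarterGateScarEnvelopeTypeINearOneRateDssAxisActivity

/-!
# Line `axis-activity` (crux `TypeIQuarterGate.ScarEnvelopeTypeI`, stmt-NavierStokesRegularity-23843) — part 2/3:
# S_D scale densification, S_G the self-similar generator identity, rescaling lemmas

LANDING NOTE.  Author: ideator seat ns-idea-7 (g3/g4), line `axis-activity` v7 (tree
`Cruxes/ScarEnvelopeTypeI/Lines/axis_activity.lean`, sha16 e0717fe785a7ef30; idea-crit-7 g2 VERDICT PASS 10:27:26Z, item L);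
landed VERBATIM under `Theorems/` by the prover hand ns-in-wu-con g2 (DIRECTOR-NS KEY-NS #135 (2)(L) / #136 (5) / inputs-15 (b2)),
split in THREE files only for the 400-line rule (declarations byte-identical; the local notation `(EuclideanSpace ℝ (Fin 3))` spelled out as
`EuclideanSpace ℝ (Fin 3)`; deprecated `push_neg` → `push Not` for 0-warning hygiene; `set_option linter.dupNamespace false` added as in every Theorems file): part 1/3 `…NearOneRateDssAxisActivity.lean` (the four statements + S_A `axisActivity_proof` +
`exists_recentred`, `isDiscretelySelfSimilar_pow`), part 2/3 `…NearOneRateDssDensification.lean` (S_D `scaleDensification_proof`,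
S_G `selfSimilarGenerator_proof`, rescaling lemmas), part 3/3 `…NearOneRateDss.lean` (the rung `nearOneRateDss_proof` and its
corollaries `chaeWolf_of_nearOneRateDss`, `twinScarObject_not_nearOneDss`, `thinObject_not_nearOneDss`, …).
No summit is proved; the line does NOT conclude crux 23843 `ScarEnvelopeTypeI`; NS regularity is NOT proved.
-/

noncomputable section

-- the summit and its single sub-problem share the name (CONVENTIONS §1), as in every Theorems file
set_option linter.dupNamespace false

namespace Summit.NavierStokesRegularity.NavierStokesRegularity.Cruxes.ScarEnvelopeTypeI.AxisActivity

open MeasureTheory Set Function Filter Topology Bornology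
open Literature.Analysis Literature.Analysis.FluidPDE
open Summit.NavierStokesRegularity.NavierStokesRegularity.Theorems
open Summit.NavierStokesRegularity.NavierStokesRegularity.Theses.ExtremalTypeIConstant

/-- **S_D PROVED (v3, 2026-08-28): scale densification.**  Reduce to `1 ≤ μ` (apply the statement at
`μ⁻¹` to the point `(μ²t, μx)`); take `kₙ = ⌊log μ / log cₙ⌋₊`, `mₙ = cₙ^{kₙ}`, so `μ/cₙ < mₙ ≤ μ` and
`mₙ → μ`; iterate the DSS (`isDiscretelySelfSimilar_pow`): `vₙ(t,x) = mₙ vₙ(mₙ²t, mₙx)`; pass to the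
limit at the MOVING arguments with the class-uniform KNSS Prop 4.1 bounds already in the tree —
`exists_norm_iteratedFDeriv_le_of_typeI M 1` (⇒ spatial Lipschitz on the slice `μ²t`, mean value
inequality) and `exists_lipschitz_time_of_typeI M 0` (time-Lipschitz on the window `[μ²t − ½, μ²t/2)`) —
plus the pointwise convergence at the fixed point `(μ²t, μx)`; conclude by uniqueness of limits.
This is also the critic's P2 (09:24:02Z) answered in the kernel: the equicontinuity input is cited BY
NAME, nothing new is landed. -/
theorem scaleDensification_proof : ScaleDensification := by
  intro M c v W hc1 hc hv hdss hW hpt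
  -- reduction to `1 ≤ μ` (apply the result at `μ⁻¹` to the point `(μ²t, μx)`)
  suffices H : ∀ μ : ℝ, 1 ≤ μ → ∀ t < 0, ∀ x : (EuclideanSpace ℝ (Fin 3)), μ • W (μ ^ 2 * t) (μ • x) = W t x by
    intro μ hμ t ht x
    rcases le_or_gt 1 μ with h1 | h1
    · exact H μ h1 t ht x
    · have hμ' : 1 ≤ μ⁻¹ := by
        have hμi : 0 < μ⁻¹ := inv_pos.2 hμ
        nlinarith [mul_inv_cancel₀ hμ.ne']
      have ht' : μ ^ 2 * t < 0 := mul_neg_of_pos_of_neg (by positivity) ht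
      have key := H μ⁻¹ hμ' (μ ^ 2 * t) ht' (μ • x)
      have e1 : μ⁻¹ ^ 2 * (μ ^ 2 * t) = t := by field_simp
      have e2 : μ⁻¹ • μ • x = x := by rw [smul_smul, inv_mul_cancel₀ hμ.ne', one_smul]
      rw [e1, e2] at key
      rw [← key, smul_smul, mul_inv_cancel₀ hμ.ne', one_smul]
  intro μ hμ1 t ht x
  have hμ : 0 < μ := zero_lt_one.trans_le hμ1
  have hlogμ : 0 ≤ Real.log μ := Real.log_nonneg hμ1
  set s : ℝ := μ ^ 2 * t with hs_def
  have hs : s < 0 := mul_neg_of_pos_of_neg (by positivity) ht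
  -- densifying exponents `k n = ⌊log μ / log cₙ⌋`, ratios `m n = cₙ ^ k n → μ`
  have hcpos : ∀ n, 0 < c n := fun n => zero_lt_one.trans (hc1 n)
  have hL : ∀ n, 0 < Real.log (c n) := fun n => Real.log_pos (hc1 n)
  set k : ℕ → ℕ := fun n => ⌊Real.log μ / Real.log (c n)⌋₊ with hk_def
  set m : ℕ → ℝ := fun n => c n ^ k n with hm_def
  have hm_pos : ∀ n, 0 < m n := fun n => pow_pos (hcpos n) _
  have hm_exp : ∀ n, m n = Real.exp ((k n : ℝ) * Real.log (c n)) := fun n => by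
    rw [Real.exp_nat_mul, Real.exp_log (hcpos n)]
  have hm_le : ∀ n, m n ≤ μ := fun n => by
    have h1 : (k n : ℝ) ≤ Real.log μ / Real.log (c n) :=
      Nat.floor_le (div_nonneg hlogμ (hL n).le)
    rw [le_div_iff₀ (hL n)] at h1
    rw [hm_exp n]
    calc Real.exp ((k n : ℝ) * Real.log (c n)) ≤ Real.exp (Real.log μ) := Real.exp_le_exp.2 h1
      _ = μ := Real.exp_log hμ
  have hm_gt : ∀ n, μ / c n < m n := fun n => by
    have h2 : Real.log μ / Real.log (c n) < (k n : ℝ) + 1 := Nat.lt_floor_add_one _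
    rw [div_lt_iff₀ (hL n)] at h2
    rw [div_lt_iff₀ (hcpos n)]
    have e : m n * c n = Real.exp (((k n : ℝ) + 1) * Real.log (c n)) := by
      rw [show ((k n : ℝ) + 1) = ((k n + 1 : ℕ) : ℝ) by push_cast; ring, Real.exp_nat_mul,
        Real.exp_log (hcpos n), pow_succ]
    rw [e]
    calc μ = Real.exp (Real.log μ) := (Real.exp_log hμ).symm
      _ < _ := Real.exp_lt_exp.2 h2
  have hm : Tendsto m atTop (𝓝 μ) := by
    have hlow : Tendsto (fun n => μ / c n) atTop (𝓝 μ) := by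
      have h : Tendsto (fun n => μ / c n) atTop (𝓝 (μ / 1)) :=
        tendsto_const_nhds.div hc one_ne_zero
      simpa using h
    exact tendsto_of_tendsto_of_tendsto_of_le_of_le hlow tendsto_const_nhds
      (fun n => (hm_gt n).le) (fun n => hm_le n)
  -- the DSS identity at the densifying ratios
  have hid : ∀ n, m n • v n (m n ^ 2 * t) (m n • x) = v n t x := fun n => by
    have h : nsRescale (m n) (v n) = v n := isDiscretelySelfSimilar_pow (hdss n) (k n)
    have h' := congrFun (congrFun h t) x
    simpa only [nsRescale_apply] using h'
  -- class-uniform bounds on the window `[s - 1/2, s/2)` (KNSS Prop. 4.1, in tree)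
  have hab : s - 1 < s / 2 := by linarith
  have hb : s / 2 < 0 := by linarith
  obtain ⟨K, hK⟩ := exists_norm_iteratedFDeriv_le_of_typeI M 1 hab hb one_half_pos
  obtain ⟨L, hL0, hLip⟩ := exists_lipschitz_time_of_typeI M 0 hab hb one_half_pos
  have hKn : ∀ n, ∀ τ ∈ Ico (s - 1 + 1 / 2) (s / 2), ∀ y : (EuclideanSpace ℝ (Fin 3)), ‖fderiv ℝ (v n τ) y‖ ≤ K :=
    fun n τ hτ y => by
    have h := hK (hv n).continuousOn_uncurry (fun t ht => (hv n).isWeaklyDivFree ht)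
      (fun s' t' hst ht' x => (hv n).mild_eq_heatExtension hst ht' x) (hv n).hasTypeITimeDecay τ hτ y
    rwa [norm_iteratedFDeriv_one] at h
  have hLn : ∀ n, ∀ σ ∈ Ico (s - 1 + 1 / 2) (s / 2), ∀ τ ∈ Ico (s - 1 + 1 / 2) (s / 2), ∀ y : (EuclideanSpace ℝ (Fin 3)),
      ‖v n τ y - v n σ y‖ ≤ L * |τ - σ| := fun n σ hσ τ hτ y => by
    have h := hLip (hv n).continuousOn_uncurry (fun t ht => (hv n).isWeaklyDivFree ht)
      (fun s' t' hst ht' x => (hv n).mild_eq_heatExtension hst ht' x) (hv n).hasTypeITimeDecay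
      σ hσ τ hτ y
    rwa [DerivInterp.norm_iteratedFDeriv_zero_sub] at h
  have hsI : s ∈ Ico (s - 1 + 1 / 2) (s / 2) := ⟨by linarith, by linarith⟩
  -- spatial Lipschitz on the slice `s` (mean value inequality)
  have hspace : ∀ n, ‖v n s (m n • x) - v n s (μ • x)‖ ≤ K * ‖m n • x - μ • x‖ := fun n => by
    have hdiff : ∀ y ∈ (univ : Set (EuclideanSpace ℝ (Fin 3))), DifferentiableAt ℝ (v n s) y := fun y _ =>
      (((hv n).contDiff_slice hs).differentiable (by simp)).differentiableAt
    exact (convex_univ).norm_image_sub_le_of_norm_fderiv_le hdiff (fun y _ => hKn n s hsI y)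
      (mem_univ _) (mem_univ _)
  -- the moving times `m n ^ 2 * t → s` eventually lie in the window
  have hsn : Tendsto (fun n => m n ^ 2 * t) atTop (𝓝 s) := (hm.pow 2).mul_const t
  have hwin : ∀ᶠ n in atTop, m n ^ 2 * t ∈ Ico (s - 1 + 1 / 2) (s / 2) := by
    have hO : Ioo (s - 1 / 2) (s / 2) ∈ 𝓝 s := Ioo_mem_nhds (by linarith) (by linarith)
    filter_upwards [hsn hO] with n hn
    exact ⟨by linarith [hn.1], hn.2⟩
  -- convergence of the moved values
  have hA : Tendsto (fun n => v n (m n ^ 2 * t) (m n • x)) atTop (𝓝 (W s (μ • x))) := by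
    rw [tendsto_iff_norm_sub_tendsto_zero]
    have g1 : Tendsto (fun n => L * |m n ^ 2 * t - s|) atTop (𝓝 0) := by
      have h := (tendsto_iff_norm_sub_tendsto_zero.1 hsn).const_mul L
      simpa [Real.norm_eq_abs] using h
    have g2 : Tendsto (fun n => K * ‖m n • x - μ • x‖) atTop (𝓝 0) := by
      have h := (tendsto_iff_norm_sub_tendsto_zero.1 (hm.smul_const x)).const_mul K
      simpa using h
    have g3 : Tendsto (fun n => ‖v n s (μ • x) - W s (μ • x)‖) atTop (𝓝 0) :=
      tendsto_iff_norm_sub_tendsto_zero.1 (hpt s hs (μ • x))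
    have gsum : Tendsto (fun n => L * |m n ^ 2 * t - s| + K * ‖m n • x - μ • x‖ +
        ‖v n s (μ • x) - W s (μ • x)‖) atTop (𝓝 0) := by
      simpa using (g1.add g2).add g3
    refine squeeze_zero' (Eventually.of_forall fun n => norm_nonneg _) ?_ gsum
    filter_upwards [hwin] with n hn
    calc ‖v n (m n ^ 2 * t) (m n • x) - W s (μ • x)‖
        = ‖(v n (m n ^ 2 * t) (m n • x) - v n s (m n • x)) + (v n s (m n • x) - v n s (μ • x)) +
            (v n s (μ • x) - W s (μ • x))‖ := by congr 1; abel
      _ ≤ ‖v n (m n ^ 2 * t) (m n • x) - v n s (m n • x)‖ + ‖v n s (m n • x) - v n s (μ • x)‖ +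
            ‖v n s (μ • x) - W s (μ • x)‖ := norm_add₃_le
      _ ≤ L * |m n ^ 2 * t - s| + K * ‖m n • x - μ • x‖ + ‖v n s (μ • x) - W s (μ • x)‖ := by
          gcongr
          · exact hLn n s hsI (m n ^ 2 * t) hn (m n • x)
          · exact hspace n
  -- conclude by uniqueness of limits
  have hB : Tendsto (fun n => m n • v n (m n ^ 2 * t) (m n • x)) atTop (𝓝 (μ • W s (μ • x))) :=
    hm.smul hA
  have hB' : Tendsto (fun n => v n t x) atTop (𝓝 (μ • W s (μ • x))) := by
    refine hB.congr' (Eventually.of_forall fun n => hid n)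
  exact (tendsto_nhds_unique hB' (hpt t ht x))

/-- **S_G PROVED (v2, 2026-08-28): the self-similar generator identity.**  Differentiate the constant
map `μ ↦ μ • W (μ² t) (μ • x)` at `μ = 1` along the curve `μ ↦ (μ² t, μ • x)` through the open slab,
where `uncurry W` is `C^∞` (`IsTypeIAncientMild.contDiffOn`); the Fréchet derivative `L` of `uncurry W` at
`(t, x)` splits as `L (2t, x) = (2t) • L (1, 0) + L (0, x) = (2t) • timeDeriv W t x + fderiv ℝ (W t) x x`. -/
theorem selfSimilarGenerator_proof : SelfSimilarGenerator := by
  intro M W hW hsc t ht x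
  have hopen : IsOpen (Iio (0 : ℝ) ×ˢ (univ : Set (EuclideanSpace ℝ (Fin 3)))) := isOpen_Iio.prod isOpen_univ
  have hmem : (t, x) ∈ Iio (0 : ℝ) ×ˢ (univ : Set (EuclideanSpace ℝ (Fin 3))) := ⟨ht, mem_univ _⟩
  have hd : DifferentiableAt ℝ (uncurry W) (t, x) :=
    ((hW.contDiffOn.differentiableOn (by simp)).differentiableAt (hopen.mem_nhds hmem))
  set L : ℝ × (EuclideanSpace ℝ (Fin 3)) →L[ℝ] (EuclideanSpace ℝ (Fin 3)) := fderiv ℝ (uncurry W) (t, x) with hLdef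
  have hL : HasFDerivAt (uncurry W) L (t, x) := hd.hasFDerivAt
  -- the curve `μ ↦ (μ² t, μ x)` and the constant map along it
  have hγ : HasDerivAt (fun μ : ℝ => (μ ^ 2 * t, μ • x))
      ((2 : ℕ) * (1 : ℝ) ^ (2 - 1) * t, (1 : ℝ) • x) 1 :=
    ((hasDerivAt_pow 2 (1 : ℝ)).mul_const t).prodMk ((hasDerivAt_id (1 : ℝ)).smul_const x)
  have hL1 : HasFDerivAt (uncurry W) L ((1 : ℝ) ^ 2 * t, (1 : ℝ) • x) := by simpa using hL
  have hG : HasDerivAt (fun μ : ℝ => uncurry W (μ ^ 2 * t, μ • x))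
      (L ((2 : ℕ) * (1 : ℝ) ^ (2 - 1) * t, (1 : ℝ) • x)) 1 := by
    have := hL1.comp_hasDerivAt (1 : ℝ) hγ
    exact this.congr_of_eventuallyEq (Eventually.of_forall fun μ => rfl)
  have hΦ : HasDerivAt (fun μ : ℝ => μ • uncurry W (μ ^ 2 * t, μ • x))
      ((id (1 : ℝ) : ℝ) • L ((2 : ℕ) * (1 : ℝ) ^ (2 - 1) * t, (1 : ℝ) • x)
        + (1 : ℝ) • uncurry W ((1 : ℝ) ^ 2 * t, (1 : ℝ) • x)) 1 := by
    have := (hasDerivAt_id (1 : ℝ)).smul hG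
    exact this.congr_of_eventuallyEq (Eventually.of_forall fun μ => rfl)
  have hev : (fun μ : ℝ => μ • uncurry W (μ ^ 2 * t, μ • x)) =ᶠ[𝓝 1] fun _ => W t x := by
    filter_upwards [Ioi_mem_nhds (zero_lt_one : (0 : ℝ) < 1)] with μ hμ
    simpa [uncurry] using hsc μ hμ t ht x
  have h0 : HasDerivAt (fun μ : ℝ => μ • uncurry W (μ ^ 2 * t, μ • x)) (0 : (EuclideanSpace ℝ (Fin 3))) 1 :=
    (hasDerivAt_const (1 : ℝ) (W t x)).congr_of_eventuallyEq hev
  have hkey : L (2 * t, x) + W t x = 0 := by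
    have h := hΦ.unique h0
    simpa [uncurry] using h
  -- identify the partial derivatives with `timeDeriv` and `fderiv` of the slice
  have htime : timeDeriv W t x = L (1, 0) := by
    have h1 : HasDerivAt (fun s : ℝ => (s, x)) ((1 : ℝ), (0 : (EuclideanSpace ℝ (Fin 3)))) t :=
      (hasDerivAt_id t).prodMk (hasDerivAt_const t x)
    have h2 : HasDerivAt (fun s : ℝ => W s x) (L ((1 : ℝ), (0 : (EuclideanSpace ℝ (Fin 3))))) t := by
      have := hL.comp_hasDerivAt t h1
      exact this.congr_of_eventuallyEq (Eventually.of_forall fun s => rfl)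
    rw [timeDeriv_apply]
    exact h2.deriv
  have hspace : fderiv ℝ (W t) x = L.comp (ContinuousLinearMap.inr ℝ ℝ (EuclideanSpace ℝ (Fin 3))) := by
    have h1 : HasFDerivAt (fun y : (EuclideanSpace ℝ (Fin 3)) => (t, y)) (ContinuousLinearMap.inr ℝ ℝ (EuclideanSpace ℝ (Fin 3))) x :=
      hasFDerivAt_prodMk_right t x
    have h2 : HasFDerivAt (W t) (L.comp (ContinuousLinearMap.inr ℝ ℝ (EuclideanSpace ℝ (Fin 3)))) x := by
      have := hL.comp x h1
      exact this.congr_of_eventuallyEq (Eventually.of_forall fun y => rfl)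
    exact h2.fderiv
  have hsplit : L (2 * t, x) = (2 * t) • L (1, 0) + L (0, x) := by
    have : ((2 * t, x) : ℝ × (EuclideanSpace ℝ (Fin 3))) = (2 * t) • ((1 : ℝ), (0 : (EuclideanSpace ℝ (Fin 3)))) + ((0 : ℝ), x) := by
      ext <;> simp
    rw [this, map_add, map_smul]
  rw [zero_add, hspace, htime, ContinuousLinearMap.comp_apply, ContinuousLinearMap.inr_apply]
  rw [hsplit] at hkey
  have : L (0, x) + W t x + (2 * t) • L (1, 0) = (2 * t) • L (1, 0) + L (0, x) + W t x := by abel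
  rw [this]; exact hkey

/-! ## Elementary facts about the scaling -/

/-- Commuting scalings: a rescaled `c`-DSS field is `c`-DSS (about the same centre, the origin). -/
theorem isDiscretelySelfSimilar_nsRescale {c μ : ℝ} {u : ℝ → (EuclideanSpace ℝ (Fin 3)) → (EuclideanSpace ℝ (Fin 3))}
    (h : IsDiscretelySelfSimilar c u) : IsDiscretelySelfSimilar c (nsRescale μ u) := by
  have e : nsRescale c u = u := h
  show nsRescale c (nsRescale μ u) = nsRescale μ u
  rw [← nsRescale_mul, mul_comm, nsRescale_mul, e]

/-- The value of the parabolic rescaling to time `−1` at the marked point: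
`(u_λ)(−1, λ⁻¹x₀) = λ u(t₀, x₀)`, `λ = √(−t₀)`. -/
theorem nsRescale_sqrt_apply {t₀ : ℝ} (ht₀ : t₀ < 0) (u : ℝ → (EuclideanSpace ℝ (Fin 3)) → (EuclideanSpace ℝ (Fin 3))) (x₀ : (EuclideanSpace ℝ (Fin 3))) :
    nsRescale (Real.sqrt (-t₀)) u (-1) ((Real.sqrt (-t₀))⁻¹ • x₀) = Real.sqrt (-t₀) • u t₀ x₀ := by
  have hs : 0 < Real.sqrt (-t₀) := Real.sqrt_pos.2 (neg_pos.2 ht₀)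
  rw [nsRescale_apply, smul_smul, mul_inv_cancel₀ hs.ne', one_smul, mul_neg_one,
    Real.sq_sqrt (neg_nonneg.2 ht₀.le), neg_neg]

/-! ## The composition: the indirect argument, kernel-checked -/

end Summit.NavierStokesRegularity.NavierStokesRegularity.Cruxes.ScarEnvelopeTypeI.AxisActivity

end
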